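/-
Copyright (c) 2026 the pub-hodgecm-mathlib formalisation cell (harness21).  Prover seat hodgecm-mathlib-F0P2-p06 (g13): road «S3-ram» (LEAD F0P3a-plan (g12); architect
A-p16 (g31); junction pen F0P3a-p01 (g17), J-PACK v2 ROW-ROOT-SLICE; owner F0P3a-p06 (g15)); 2026-09-02.
-/
import Literature.NumberTheory.Automorphic.UnitaryLatticeTreeFixedGrandchildrenSliceCountRamified   -- ★ p847357 (this seat, g12): J6-mult, the slice count at `v ≠ r₀` (brings ★ G3⁺ p847297, ★ G3 p847251, ★ G1)
import HarnessLib

/-!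
# The lattice graph of a hermitian space — THE SLICE COUNT AT THE ROOT: `#{w ∈ GC(r₀) : P w} = q · #{neighbours c of r₀ : P holds two steps out along c}`
# for a slice-constant label `P`, when `γ ≡ 1 (mod ϖ²)` (Kottwitz 1986 §3; Serre, *Trees* I.2.3, II.1.1; Bruhat–Tits 1972 §10)

Topic `NumberTheory/Automorphic`; namespace `Literature.NumberTheory.Automorphic.UnitaryLatticeTree`.  THEOREMS ONLY (no definition, no instance, no notation, no named fact,
no `sorry`); kernel lane `--supports stmt-HodgeConjecture-24833`.  Cell `pub/hodgecm-mathlib` (D-0151), crux H413; road «S3-ram» (Literature seeding, count-neutral);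
J-PACK v2 (junction pen F0P3a-p01 (g17)) **ROW-ROOT-SLICE** — the socket `row_rootSlice` (skeleton v2 :141 ≡ v3), binder order verbatim.  It is the ROOT TWIN of ★ J6-mult
`ncard_fixedGrandchildren_sep_eq_mul_ncard_passingChildren` (which wants `v ≠ r₀`): at the root `r₀ = L₀` there is no parent, all `q + 1` neighbours `κ·N₁` (`κ ∈ K₀`,
★ `mem_neighborSet_latticeGraphIso_root_iff` at `u = 1`) are children, every one of them is fixed (`γ ∈ K₀`, `γ ≡ 1 (ϖ)`: ★ G3 `mapGL_eq_self_of_mem_neighborSet_latticeGraphIso_root_of_congr`)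
and PASSES (`γ ≡ 1 (ϖ²)`: ★ G3⁺ `ncard_fixed_children_latticeGraphIso_of_congr_sq` — the slice through `κ·N₁` carries exactly `q` fixed vertices at distance `2`); the slices are
disjoint in the rooted tree (★ G1 `exists_rooted_parent`), and a SLICE-CONSTANT `P` keeps a whole slice or nothing.  Hence
  **`#{w ∈ GC(r₀) : P w} = q · #{c ~ r₀ : ∀ w ~ c, dist(r₀,w) = 2 → P w}`.**

HONEST LABEL: HC_CM is proved only modulo the 2 remaining named inputs (hLiu418 24832, h413 24833) until rung 0 closes; nothing printed is asserted here (rooted-tree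
bookkeeping over ★ results); «S3-ram» has no books consequence.

## References
* [Kottwitz1986] R. E. Kottwitz, *Base change for unit elements of Hecke algebras*, Compositio Math. 60 (1986), §3 (counting fixed lattices shell by shell).
* [Serre1980Trees] J.-P. Serre, *Trees* (1980), Ch. I §2.3 (rooted trees), Ch. II §1.1 (neighbours of a lattice; fixed subtrees).
* [BruhatTits1972] F. Bruhat, J. Tits, *Groupes réductifs sur un corps local I*, Publ. Math. IHÉS 41 (1972), §10.
* [Tits1979] J. Tits, *Reductive groups over local fields*, PSPM 33.1 (1979), §2.4, §3.5.
-/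

set_option autoImplicit false

noncomputable section

open scoped Valued WithZero Matrix MatrixGroups

namespace Literature.NumberTheory.Automorphic.UnitaryLatticeTree

open Literature.NumberTheory.Automorphic Literature.NumberTheory.Automorphic.HermitianLattice
open Literature.NumberTheory.Automorphic.CartanUnique
open Literature.Combinatorics.SimpleGraph.TreeLayers

variable {K : Type*} [Field K] [Valued K ℤᵐ⁰] {σ : K →+* K} {ϖ : K}

/-- The `ncard` of a finite pairwise-disjoint union indexed by a finset is the sum of the `ncard`s (folklore bookkeeping, as in ★ G1∕G3⁺∕J6-mult). [cite: Serre1980Trees, I.2.3] -/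
private theorem ncard_biUnion_finset_eq_sum_of_disjoint_rootSlice {ι α : Type*} [DecidableEq ι] (I : Finset ι) (S : ι → Set α)
    (hfin : ∀ i ∈ I, (S i).Finite) (hdisj : ∀ i ∈ I, ∀ j ∈ I, i ≠ j → Disjoint (S i) (S j)) :
    (⋃ i ∈ I, S i).ncard = ∑ i ∈ I, (S i).ncard := by
  induction I using Finset.induction_on with
  | empty => simp
  | insert a I haI ih =>
    have hfin' : ∀ i ∈ I, (S i).Finite := fun i hi => hfin i (Finset.mem_insert_of_mem hi)
    have hdisj' : ∀ i ∈ I, ∀ j ∈ I, i ≠ j → Disjoint (S i) (S j) := fun i hi j hj =>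
      hdisj i (Finset.mem_insert_of_mem hi) j (Finset.mem_insert_of_mem hj)
    rw [Finset.set_biUnion_insert, Finset.sum_insert haI, ← ih hfin' hdisj']
    refine Set.ncard_union_eq ?_ (hfin a (Finset.mem_insert_self a I)) (Set.Finite.biUnion I.finite_toSet hfin')
    rw [Set.disjoint_iUnion₂_right]
    exact fun i hi => hdisj a (Finset.mem_insert_self a I) i (Finset.mem_insert_of_mem hi) (fun h => haI (h ▸ hi))

section Three

/-- **ROW-ROOT-SLICE «SLICE COUNT AT THE ROOT» (J-PACK v2 §2, socket `row_rootSlice`)**: for `γ ∈ K₀` with `γ ≡ 1 (mod ϖ²)` entrywise and a predicate `P` constant on the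
vertices two steps out along each neighbour of the root, `#{w ∈ GC(r₀) : P w} = q · #{c ~ r₀ : ∀ w ~ c, dist(r₀, w) = 2 → P w}` — at `r₀` all `q + 1` neighbours are children and
all of them pass. [cite: Kottwitz1986, §3] [cite: Serre1980Trees, I.2.3, II.1.1] [cite: Tits1979, §3.5] [cite: BruhatTits1972, §10] -/
theorem ncard_rootGrandchildren_sep_eq_mul_ncard_of_congr_sq (hσ : ∀ x, σ (σ x) = x) (hvσ : ∀ a, Valued.v (σ a) = Valued.v a) (hσϖ : σ ϖ = -ϖ)
    (hϖ : Valued.v ϖ = WithZero.exp (-1 : ℤ)) (hres : ∀ x : K, Valued.v x ≤ 1 → Valued.v (σ x - x) < 1) (h2 : Valued.v (2 : K) = 1) [Finite 𝓀[K]]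
    (hT : (latticeGraph σ ϖ ((StdForm.antidiagonal 3).over K)).IsTree)
    {γ : unitaryGroupOfForm σ ((StdForm.antidiagonal 3).over K)} (hγ0 : γ ∈ unitaryInt σ ((StdForm.antidiagonal 3).over K))
    (hdeep : ∀ i j, Valued.v ((((γ : GL (Fin 3) K) : Matrix (Fin 3) (Fin 3) K) - 1) i j) ≤ Valued.v ϖ ^ 2)
    (P : {M : Submodule 𝒪[K] (Fin 3 → K) // IsVertex σ ϖ ((StdForm.antidiagonal 3).over K) M} → Prop)
    (hP : ∀ c, (latticeGraph σ ϖ ((StdForm.antidiagonal 3).over K)).Adj ⟨stdLattice K 3, 0, isSelfDualLattice_stdLattice_three_of_v hϖ⟩ c → ∀ w w', (latticeGraph σ ϖ ((StdForm.antidiagonal 3).over K)).Adj c w → (latticeGraph σ ϖ ((StdForm.antidiagonal 3).over K)).dist ⟨stdLattice K 3, 0, isSelfDualLattice_stdLattice_three_of_v hϖ⟩ w = 2 → (latticeGraph σ ϖ ((StdForm.antidiagonal 3).over K)).Adj c w' → (latticeGraph σ ϖ ((StdForm.antidiagonal 3).over K)).dist ⟨stdLattice K 3, 0, isSelfDualLattice_stdLattice_three_of_v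 hϖ⟩ w' = 2 → (P w ↔ P w')) :
    ({w | w ∈ {w | ∃ c, ((latticeGraph σ ϖ ((StdForm.antidiagonal 3).over K)).Adj ⟨stdLattice K 3, 0, isSelfDualLattice_stdLattice_three_of_v hϖ⟩ c ∧ (latticeGraph σ ϖ ((StdForm.antidiagonal 3).over K)).dist ⟨stdLattice K 3, 0, isSelfDualLattice_stdLattice_three_of_v hϖ⟩ c = (latticeGraph σ ϖ ((StdForm.antidiagonal 3).over K)).dist ⟨stdLattice K 3, 0, isSelfDualLattice_stdLattice_three_of_v hϖ⟩ ⟨stdLattice K 3, 0, isSelfDualLattice_stdLattice_three_of_v hϖ⟩ + 1 ∧ latticeGraphIso σ ϖ ((StdForm.antidiagonal 3).over K) γ c = c) ∧ ((latticeGraph σ ϖ ((StdForm.antidiagonal 3).over K)).Adj c w ∧ (latticeGraph σ ϖ ((StdForm.antidiagonal 3).over K)).dist ⟨stdLattice K 3, 0, isSelfDualLattice_stdLattice_three_of_v hϖ⟩ w = (latticeGraph σ ϖ ((StdForm.antidiagonal 3).over K)).dist ⟨stdLattice K 3, 0, isSelfDualLattice_stdLattice_three_of_v hϖ⟩ c +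 1 ∧ latticeGraphIso σ ϖ ((StdForm.antidiagonal 3).over K) γ w = w)} ∧ (P w)}).ncard =
      Nat.card 𝓀[K] * {c | (latticeGraph σ ϖ ((StdForm.antidiagonal 3).over K)).Adj ⟨stdLattice K 3, 0, isSelfDualLattice_stdLattice_three_of_v hϖ⟩ c ∧ ∀ w, (latticeGraph σ ϖ ((StdForm.antidiagonal 3).over K)).Adj c w → (latticeGraph σ ϖ ((StdForm.antidiagonal 3).over K)).dist ⟨stdLattice K 3, 0, isSelfDualLattice_stdLattice_three_of_v hϖ⟩ w = 2 → P w}.ncard := by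
  classical
  -- notation-free abbreviations
  set G := latticeGraph σ ϖ ((StdForm.antidiagonal 3).over K) with hG
  set r : {M : Submodule 𝒪[K] (Fin 3 → K) // IsVertex σ ϖ ((StdForm.antidiagonal 3).over K) M} := ⟨stdLattice K 3, 0, isSelfDualLattice_stdLattice_three_of_v hϖ⟩ with hr
  have hϖ1 : Valued.v ϖ < 1 := by rw [hϖ, ← WithZero.exp_zero]; exact WithZero.exp_lt_exp.2 (by norm_num)
  -- the rooted parent map
  obtain ⟨p, -, hchild, hproot, -⟩ := exists_rooted_parent hT r
  -- the root is `1·r₀`; `γ = 1⁻¹γ1 ∈ K₀`, `γ ≡ 1 (mod ϖ²)`, hence `(mod ϖ)`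
  have hr1 : latticeGraphIso σ ϖ ((StdForm.antidiagonal 3).over K) 1 r = r := latticeGraphIso_one_apply r
  have hγK : (1⁻¹ * γ * 1 : unitaryGroupOfForm σ ((StdForm.antidiagonal 3).over K)) ∈ unitaryInt σ ((StdForm.antidiagonal 3).over K) := by
    simpa only [inv_one, one_mul, mul_one] using hγ0
  have hγϖ2 : ∀ i j, Valued.v (((((1⁻¹ * γ * 1 : unitaryGroupOfForm σ ((StdForm.antidiagonal 3).over K)) : GL (Fin 3) K) : Matrix (Fin 3) (Fin 3) K) - 1) i j) ≤ Valued.v ϖ ^ 2 := by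
    intro i j; simpa only [inv_one, one_mul, mul_one] using hdeep i j
  have hγϖ : ∀ i j, Valued.v (((((1⁻¹ * γ * 1 : unitaryGroupOfForm σ ((StdForm.antidiagonal 3).over K)) : GL (Fin 3) K) : Matrix (Fin 3) (Fin 3) K) - 1) i j) ≤ Valued.v ϖ :=
    fun i j => (hγϖ2 i j).trans (by rw [sq]; exact mul_le_of_le_one_left zero_le hϖ1.le)
  have hγ1 : ∀ i j, Valued.v (((((1⁻¹ * γ * 1 : unitaryGroupOfForm σ ((StdForm.antidiagonal 3).over K)) : GL (Fin 3) K) : Matrix (Fin 3) (Fin 3) K) - 1) i j) < 1 := fun i j => lt_of_le_of_lt (hγϖ i j) hϖ1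
  -- the neighbours of the root: frames `κ·N₁`, all fixed, all at distance `1`
  have hnb : ∀ c, G.Adj r c → ∃ κ : unitaryGroupOfForm σ ((StdForm.antidiagonal 3).over K), κ ∈ unitaryInt σ ((StdForm.antidiagonal 3).over K) ∧ c = latticeGraphIso σ ϖ ((StdForm.antidiagonal 3).over K) (1 * κ) ⟨latt (Matrix.diagonal ![(1 : K), 1, ϖ]), 2, isVertexLattice_two_N₁_of_neg hσϖ hϖ⟩ := fun c hc =>
    (mem_neighborSet_latticeGraphIso_root_iff hσ hvσ hσϖ hϖ h2 1 c).1 (by rw [SimpleGraph.mem_neighborSet, hr1]; exact hc)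
  have hnbfix : ∀ c, G.Adj r c → latticeGraphIso σ ϖ ((StdForm.antidiagonal 3).over K) γ c = c := fun c hc =>
    (latticeGraphIso_eq_iff_mapGL_eq γ c).2
      (mapGL_eq_self_of_mem_neighborSet_latticeGraphIso_root_of_congr hσ hvσ hσϖ hϖ h2 hγK hγ1 (by rw [SimpleGraph.mem_neighborSet, hr1]; exact hc))
  have hd1 : ∀ c, G.Adj r c → G.dist r c = 1 := fun c hc => SimpleGraph.dist_eq_one_iff_adj.2 hc
  -- the slice through a neighbour `c` of the root: its neighbours other than the root that are fixed
  have hslice : ∀ c, G.Adj r c →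
      {w | G.Adj c w ∧ G.dist r w = G.dist r c + 1 ∧ latticeGraphIso σ ϖ ((StdForm.antidiagonal 3).over K) γ w = w} =
        {w | w ∈ G.neighborSet c ∧ w.1 ≠ mapGL ((1 : unitaryGroupOfForm σ ((StdForm.antidiagonal 3).over K)) : GL (Fin 3) K) (stdLattice K 3) ∧ mapGL (γ : GL (Fin 3) K) w.1 = w.1} := by
    intro c hadj
    have hcr : c ≠ r := fun h => (G.ne_of_adj hadj) h.symm
    have hL₀ : mapGL ((1 : unitaryGroupOfForm σ ((StdForm.antidiagonal 3).over K)) : GL (Fin 3) K) (stdLattice K 3) = r.1 := by rw [Subgroup.coe_one, mapGL_one]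
    ext w
    simp only [Set.mem_setOf_eq, SimpleGraph.mem_neighborSet]
    constructor
    · rintro ⟨hcw, hdw, hfw⟩
      refine ⟨hcw, fun heq => ?_, (latticeGraphIso_eq_iff_mapGL_eq γ w).1 hfw⟩
      have hwr : w = r := Subtype.ext (by rw [heq, hL₀])
      rw [hwr, SimpleGraph.dist_self] at hdw
      omega
    · rintro ⟨hcw, hne, hfw⟩
      have hwp : w ≠ p c := by
        rw [hproot c hadj]; intro hwr; apply hne; rw [hwr, hL₀]
      exact ⟨hcw, (hchild c w hcr hcw hwp).1, (latticeGraphIso_eq_iff_mapGL_eq γ w).2 hfw⟩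
  -- every slice carries `q` fixed vertices (`γ ≡ 1 (mod ϖ²)`: every neighbour of the root passes)
  have hslicecount : ∀ c, G.Adj r c → {w | G.Adj c w ∧ G.dist r w = G.dist r c + 1 ∧ latticeGraphIso σ ϖ ((StdForm.antidiagonal 3).over K) γ w = w}.ncard = Nat.card 𝓀[K] := by
    intro c hadj
    rw [hslice c hadj]
    obtain ⟨κ, hκK, rfl⟩ := hnb c hadj
    exact ncard_fixed_children_latticeGraphIso_of_congr_sq hvσ hσϖ hϖ hres hγK hκK hγϖ2
  have hslicefin0 : ∀ c, G.Adj r c → {w | G.Adj c w ∧ G.dist r w = G.dist r c + 1 ∧ latticeGraphIso σ ϖ ((StdForm.antidiagonal 3).over K) γ w = w}.Finite := fun c hadj =>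
    Set.finite_of_ncard_ne_zero (by rw [hslicecount c hadj]; exact (Nat.card_pos (α := 𝓀[K])).ne')
  -- the `P`-slice count: `q` if `P` holds along the slice, `0` otherwise
  have hslicecountP : ∀ c, G.Adj r c →
      {w | G.Adj c w ∧ G.dist r w = G.dist r c + 1 ∧ latticeGraphIso σ ϖ ((StdForm.antidiagonal 3).over K) γ w = w ∧ P w}.ncard =
        if (∀ w, G.Adj c w → G.dist r w = 2 → P w) then Nat.card 𝓀[K] else 0 := by
    intro c hadj
    have hsub : {w | G.Adj c w ∧ G.dist r w = G.dist r c + 1 ∧ latticeGraphIso σ ϖ ((StdForm.antidiagonal 3).over K) γ w = w ∧ P w} ⊆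
        {w | G.Adj c w ∧ G.dist r w = G.dist r c + 1 ∧ latticeGraphIso σ ϖ ((StdForm.antidiagonal 3).over K) γ w = w} := fun w hw => ⟨hw.1, hw.2.1, hw.2.2.1⟩
    have hcount := hslicecount c hadj
    have hdc := hd1 c hadj
    by_cases hall : ∀ w, G.Adj c w → G.dist r w = 2 → P w
    · rw [if_pos hall, ← hcount]
      congr 1
      ext w
      simp only [Set.mem_setOf_eq]
      exact ⟨fun h => ⟨h.1, h.2.1, h.2.2.1⟩, fun h => ⟨h.1, h.2.1, h.2.2, hall w h.1 (by rw [h.2.1, hdc])⟩⟩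
    · rw [if_neg hall]
      push Not at hall
      obtain ⟨w₁, hw₁, hdw₁, hPw₁⟩ := hall
      rw [Set.ncard_eq_zero ((hslicefin0 c hadj).subset hsub)]
      ext w
      simp only [Set.mem_setOf_eq, Set.mem_empty_iff_false, iff_false, not_and]
      intro hcw hdw _ hPw
      exact hPw₁ ((hP c hadj w w₁ hcw (by rw [hdw, hdc]) hw₁ hdw₁).1 hPw)
  -- the neighbours of the root as a finset
  have hstar : (G.neighborSet r).ncard = Nat.card 𝓀[K] + 1 := ncard_neighborSet_root_of_ramified hσ hvσ hϖ hres h2 (isVertexLattice_two_N₁_of_neg hσϖ hϖ)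
  have hfin : (G.neighborSet r).Finite := Set.finite_of_ncard_ne_zero (by rw [hstar]; exact Nat.succ_ne_zero _)
  set I := hfin.toFinset with hI
  have hmemI : ∀ c, c ∈ I ↔ G.Adj r c := fun c => by rw [hI, Set.Finite.mem_toFinset, SimpleGraph.mem_neighborSet]
  -- the `P`-part of `GC(r₀)` as a disjoint union of `P`-slices over the neighbours of the root
  have hunion : {w | w ∈ {w | ∃ c, (G.Adj r c ∧ G.dist r c = G.dist r r + 1 ∧ latticeGraphIso σ ϖ ((StdForm.antidiagonal 3).over K) γ c = c) ∧ (G.Adj c w ∧ G.dist r w = G.dist r c + 1 ∧ latticeGraphIso σ ϖ ((StdForm.antidiagonal 3).over K) γ w = w)} ∧ P w} =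
      ⋃ c ∈ I, {w | G.Adj c w ∧ G.dist r w = G.dist r c + 1 ∧ latticeGraphIso σ ϖ ((StdForm.antidiagonal 3).over K) γ w = w ∧ P w} := by
    ext w
    simp only [Set.mem_setOf_eq, Set.mem_iUnion, exists_prop]
    constructor
    · rintro ⟨⟨c, ⟨hadj, -, -⟩, hw⟩, hPw⟩
      exact ⟨c, (hmemI c).2 hadj, hw.1, hw.2.1, hw.2.2, hPw⟩
    · rintro ⟨c, hc, hcw, hdw, hfw, hPw⟩
      have hadj := (hmemI c).1 hc
      exact ⟨⟨c, ⟨hadj, by rw [SimpleGraph.dist_self, hd1 c hadj], hnbfix c hadj⟩, hcw, hdw, hfw⟩, hPw⟩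
  have hdisj : ∀ c ∈ I, ∀ c' ∈ I, c ≠ c' →
      Disjoint {w | G.Adj c w ∧ G.dist r w = G.dist r c + 1 ∧ latticeGraphIso σ ϖ ((StdForm.antidiagonal 3).over K) γ w = w ∧ P w}
        {w | G.Adj c' w ∧ G.dist r w = G.dist r c' + 1 ∧ latticeGraphIso σ ϖ ((StdForm.antidiagonal 3).over K) γ w = w ∧ P w} := by
    intro c hc c' hc' hne
    have hadj := (hmemI c).1 hc
    have hadj' := (hmemI c').1 hc'
    rw [Set.disjoint_left]
    rintro w ⟨hcw, hdw, -, -⟩ ⟨hc'w, -, -, -⟩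
    have hwr : w ≠ r := by
      intro hwr; rw [hwr, SimpleGraph.dist_self] at hdw; omega
    have hwpc : w ≠ p c := by rw [hproot c hadj]; exact hwr
    have hwpc' : w ≠ p c' := by rw [hproot c' hadj']; exact hwr
    exact hne (((hchild c w (fun h => (G.ne_of_adj hadj) h.symm) hcw hwpc).2).symm.trans
      (hchild c' w (fun h => (G.ne_of_adj hadj') h.symm) hc'w hwpc').2)
  have hslicefin : ∀ c ∈ I, {w | G.Adj c w ∧ G.dist r w = G.dist r c + 1 ∧ latticeGraphIso σ ϖ ((StdForm.antidiagonal 3).over K) γ w = w ∧ P w}.Finite := fun c hc =>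
    (hslicefin0 c ((hmemI c).1 hc)).subset (fun w hw => ⟨hw.1, hw.2.1, hw.2.2.1⟩)
  -- sum the slices
  rw [hunion, ncard_biUnion_finset_eq_sum_of_disjoint_rootSlice I _ hslicefin hdisj,
    Finset.sum_congr rfl (fun c hc => hslicecountP c ((hmemI c).1 hc)),
    Finset.sum_ite, Finset.sum_const_zero, add_zero, Finset.sum_const, smul_eq_mul, mul_comm]
  congr 1
  rw [← Set.ncard_coe_finset]
  congr 1
  ext c
  simp only [Finset.coe_filter, Set.mem_setOf_eq, hmemI]
  exact Iff.rfl

end Three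

end Literature.NumberTheory.Automorphic.UnitaryLatticeTree

end
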